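import Mathlib.MeasureTheory.Measure.Prokhorov
import Mathlib.MeasureTheory.Measure.LevyProkhorovMetric
import Literature.MathematicalPhysics.KineticTheory.RegularStationaryState
import Summits.AtomisticToContinuum.HydrodynamicLimit.Theorems.AntiMazurCoboundariesCorrectorPressureDecayTangentTightnessVagueLimit
import Summits.AtomisticToContinuum.HydrodynamicLimit.Theorems.AntiMazurCoboundariesCorrectorPressureDecayTangentTightnessCountBorel

/-!
# Tangent tightness, compactness III: hard-core laws are vaguely relatively compact (line `FirstLemma`, crux stmt-AtomisticToContinuum-14135)

Discharge of the registered stub `stub_hardCoreLawsVaguelyCompact` — the body of the named fact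
`HardCoreLawsVaguelyCompact` (Kallenberg 2002, Lemma 16.15 + Thm. 16.16 + Thm. A2.3 (ii), specialised to laws
of `δ`-hard-core simple configurations in `ℝᵈ × ℝᵈ`): every sequence of probability laws of `δ`-hard-core
configurations has a `δ`-hard-core probability vague cluster point
(`PointProcess.IsVagueClusterPoint`: Laplace functionals converge along a subsequence for every continuous
compactly supported `f ≥ 0`). Namespace `Summit.AtomisticToContinuum.HydrodynamicLimit.Theorems.KiferCompactification`.

## Proof (embedding by exponential statistics of a separating family)

* `exists_separating_family`: on a proper metric space there is a countable family `g n ∈ C_c⁺` whose linear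
  statistics `∑_{p ∈ ω} g n p` SEPARATE locally finite configurations (tents
  `x ↦ max 0 (1 - dist x (u i) · (m + 1))` about a dense sequence `u`: a point `p ∈ ω ∖ ω'` is isolated in
  `ω ∪ ω'` and a small tent about a centre near `p` sees `p` in `ω` and nothing in `ω'`);
* the map `F ω = (exp (-∑_{p ∈ ω} g n p))ₙ : PointConfig X → (ℕ → [0, 1])` is vaguely continuous,
  count-measurable (`measurable_exp_neg_finsum`) and injective; on `δ`-separated configurations, convergence
  of `F` is vague convergence (`tendsto_of_tendsto_expStat`, sub-subsequence argument with
  `stub_vagueSeqCompactOfSeparated`);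
* the image `Z = F(K_δ)` of the hard-core configurations is closed (`isClosed_image_expStat`, again by
  sequential compactness; vague limits of hard-core configurations are hard core, `isHardCore_of_approached`)
  inside the compact cube, hence a compact metrisable space; the inverse `S : Z → K_δ` is vaguely continuous,
  hence count-measurable (`stub_measurableOfVagueContinuous`);
* push the laws to `Z` (Mathlib: `ProbabilityMeasure Z` is compact and, by Lévy–Prokhorov, metrisable),
  extract a convergent subsequence, pull the limit back by `S`; Laplace functionals of `C_c⁺` test functions
  are expectations of bounded continuous functions on `Z`.

No new definitions. References: O. Kallenberg, *Foundations of Modern Probability* (2002), Lemma 16.15,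
Thm. 16.16, Thm. A2.3.
-/

noncomputable section

open MeasureTheory Set Filter Topology Function Metric
open scoped ENNReal BoundedContinuousFunction

namespace Summit.AtomisticToContinuum.HydrodynamicLimit.Theorems.KiferCompactification

open Literature.Analysis.FunctionSpaces (PointConfig)
open Literature.Analysis.FluidPDE (IsHardCore isHardCore_empty)
open Literature.MathematicalPhysics.KineticTheory.PointProcess (laplaceFunctional IsVagueClusterPoint
  measurable_exp_neg_finsum)

/-! ## Tents -/

section Tent

variable {X : Type*} [MetricSpace X]

/-- The tent `x ↦ max 0 (1 - dist x u / r)` is continuous. -/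
theorem continuous_tent (u : X) (r : ℝ) : Continuous fun x => max 0 (1 - dist x u / r) :=
  continuous_const.max (continuous_const.sub ((continuous_id.dist continuous_const).div_const r))

/-- The tent is positive on the open ball. -/
theorem tent_pos {u : X} {r : ℝ} (hr : 0 < r) {x : X} (hx : dist x u < r) :
    0 < max 0 (1 - dist x u / r) :=
  lt_max_of_lt_right (by rwa [sub_pos, div_lt_one hr])

/-- The tent vanishes off the open ball. -/
theorem tent_eq_zero {u : X} {r : ℝ} (hr : 0 < r) {x : X} (hx : r ≤ dist x u) :
    max 0 (1 - dist x u / r) = 0 :=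
  max_eq_left (by rwa [sub_nonpos, one_le_div hr])

/-- The support of the tent is contained in the open ball. -/
theorem support_tent_subset {u : X} {r : ℝ} (hr : 0 < r) :
    (support fun x => max 0 (1 - dist x u / r)) ⊆ ball u r :=
  fun x hx => by
    rw [mem_ball]
    by_contra h
    exact hx (tent_eq_zero hr (not_lt.1 h))

/-- On a proper space tents of positive radius have compact support. -/
theorem hasCompactSupport_tent [ProperSpace X] (u : X) {r : ℝ} (hr : 0 < r) :
    HasCompactSupport fun x => max 0 (1 - dist x u / r) :=
  HasCompactSupport.intro (isCompact_closedBall u r) fun _ hx =>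
    tent_eq_zero hr (le_of_lt (not_le.1 fun h => hx (mem_closedBall.2 h)))

/-- **A countable separating family of test functions.** On a nonempty proper metric space there is a
sequence `g n` of continuous, compactly supported, nonnegative functions whose linear statistics separate
locally finite configurations: `∑_{p ∈ ω} g n p = ∑_{p ∈ ω'} g n p` for all `n` forces `ω = ω'` (the tents of
radii `1/(m+1)` about a dense sequence: a point `p ∈ ω ∖ ω'` is isolated in `ω ∪ ω'`, and a small tent about a
centre near `p` sees `p` in `ω` and nothing in `ω'`). -/
theorem exists_separating_family [ProperSpace X] [Nonempty X] :
    ∃ g : ℕ → X → ℝ, (∀ n, Continuous (g n)) ∧ (∀ n, HasCompactSupport (g n)) ∧ (∀ n x, 0 ≤ g n x) ∧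
      ∀ ω ω' : PointConfig X, (∀ n, ω.sumFn (g n) = ω'.sumFn (g n)) → ω = ω' := by
  obtain ⟨u, hu⟩ := TopologicalSpace.exists_dense_seq X
  refine ⟨fun n x => max 0 (1 - dist x (u n.unpair.1) / (1 / ((n.unpair.2 : ℝ) + 1))),
    fun n => continuous_tent _ _, fun n => hasCompactSupport_tent _ Nat.one_div_pos_of_nat,
    fun n x => le_max_left _ _, ?_⟩
  suffices key : ∀ ω ω' : PointConfig X,
      (∀ n : ℕ, ω.sumFn (fun x => max 0 (1 - dist x (u n.unpair.1) / (1 / ((n.unpair.2 : ℝ) + 1)))) =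
        ω'.sumFn (fun x => max 0 (1 - dist x (u n.unpair.1) / (1 / ((n.unpair.2 : ℝ) + 1))))) →
      ∀ p ∈ ω, p ∈ ω' from
    fun ω ω' h => PointConfig.ext fun p => ⟨key ω ω' h p, key ω' ω (fun n => (h n).symm) p⟩
  intro ω ω' h p hp
  by_contra hp'
  -- `p` is isolated in `ω ∪ ω'`
  have hfin : (((ω : Set X) ∪ (ω' : Set X)) ∩ closedBall p 1).Finite := by
    rw [union_inter_distrib_right]
    exact (ω.finite_inter_isCompact _ (isCompact_closedBall p 1)).union
      (ω'.finite_inter_isCompact _ (isCompact_closedBall p 1))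
  set A : Set X := (((ω : Set X) ∪ (ω' : Set X)) ∩ closedBall p 1) \ {p} with hA
  have hAc : IsClosed A := (hfin.subset sdiff_subset).isClosed
  have hpA : p ∉ A := fun h => h.2 rfl
  obtain ⟨ε, hε, hεA⟩ := Metric.isOpen_iff.1 hAc.isOpen_compl p hpA
  have hiso : ∀ x ∈ (ω : Set X) ∪ (ω' : Set X), dist x p < min ε 1 → x = p := by
    intro x hx hxp
    by_contra hne
    have hxA : x ∈ A := ⟨⟨hx, mem_closedBall.2 (hxp.le.trans (min_le_right _ _))⟩, hne⟩
    exact hεA (mem_ball.2 (hxp.trans_le (min_le_left _ _))) hxA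
  -- a probe tent isolating `p`
  have hε1 : 0 < min ε 1 := lt_min hε one_pos
  obtain ⟨m, hm⟩ := exists_nat_one_div_lt (half_pos hε1)
  set r : ℝ := 1 / ((m : ℝ) + 1) with hr_def
  have hr : 0 < r := Nat.one_div_pos_of_nat
  obtain ⟨i, hi⟩ := hu.exists_dist_lt p hr
  have hn := h (Nat.pair i m)
  simp only [Nat.unpair_pair] at hn
  have hball : ∀ x, x ∈ (support fun x => max 0 (1 - dist x (u i) / r)) → dist x p < min ε 1 := by
    intro x hx
    have h1 : dist x (u i) < r := support_tent_subset hr hx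
    calc dist x p ≤ dist x (u i) + dist p (u i) := dist_triangle_right _ _ _
      _ < r + r := add_lt_add h1 hi
      _ ≤ min ε 1 := by linarith
  have h1 : ω'.sumFn (fun x => max 0 (1 - dist x (u i) / r)) = 0 := by
    rw [PointConfig.sumFn_def]
    refine finsum_mem_of_eqOn_zero fun x hx => ?_
    by_contra hne
    have hxp := hiso x (Or.inr hx) (hball x hne)
    rw [hxp] at hx
    exact hp' hx
  have h2 : ω.sumFn (fun x => max 0 (1 - dist x (u i) / r)) = max 0 (1 - dist p (u i) / r) := by
    rw [PointConfig.sumFn_def, finsum_mem_inter_support_eq _ _ {p}, finsum_mem_singleton]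
    ext x
    constructor
    · rintro ⟨hx, hxs⟩
      exact ⟨hiso x (Or.inl hx) (hball x hxs), hxs⟩
    · rintro ⟨rfl, hxs⟩
      exact ⟨hp, hxs⟩
  have h3 : 0 < max 0 (1 - dist p (u i) / r) := tent_pos hr hi
  rw [h1, h2] at hn
  exact absurd hn h3.ne'

end Tent

/-! ## Exponential statistics of a family of test functions -/

section ExpStat

variable {X : Type*} [MetricSpace X] {g : ℕ → X → ℝ}

/-- Exponential statistics `exp (-∑_{p ∈ ω} g n p)` of nonnegative test functions lie in `[0, 1]`. -/
theorem expStat_mem_Icc (hg0 : ∀ n x, 0 ≤ g n x) (ω : PointConfig X) (n : ℕ) :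
    Real.exp (-(ω.sumFn (g n))) ∈ Icc (0 : ℝ) 1 :=
  ⟨(Real.exp_pos _).le, Real.exp_le_one_iff.2 (neg_nonpos.2 (ω.sumFn_nonneg (hg0 n)))⟩

/-- Exponential statistics of `C_c` test functions are vaguely continuous, jointly as a map into the
product `ℕ → ℝ`. -/
theorem continuous_expStat (hgc : ∀ n, Continuous (g n)) (hgs : ∀ n, HasCompactSupport (g n)) :
    Continuous fun (ω : PointConfig X) (n : ℕ) => Real.exp (-(ω.sumFn (g n))) :=
  continuous_pi fun n => Real.continuous_exp.comp (PointConfig.continuous_sumFn' (hgc n) (hgs n)).neg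

/-- Exponential statistics of a separating family are injective. -/
theorem injective_expStat
    (hsepg : ∀ ω ω' : PointConfig X, (∀ n, ω.sumFn (g n) = ω'.sumFn (g n)) → ω = ω') :
    Injective fun (ω : PointConfig X) (n : ℕ) => Real.exp (-(ω.sumFn (g n))) :=
  fun ω ω' h => hsepg ω ω' fun n => neg_injective (Real.exp_injective (congr_fun h n))

variable [ProperSpace X]

/-- Exponential statistics of `C_c⁺` test functions are measurable for the count σ-algebra. -/
theorem measurable_expStat [MeasurableSpace X] [BorelSpace X] (hgc : ∀ n, Continuous (g n))
    (hgs : ∀ n, HasCompactSupport (g n)) (hg0 : ∀ n x, 0 ≤ g n x) :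
    Measurable fun (ω : PointConfig X) (n : ℕ) => Real.exp (-(ω.sumFn (g n))) :=
  measurable_pi_lambda _ fun n => measurable_exp_neg_finsum (hgc n).measurable (hgs n) (hg0 n)

/-- **On uniformly separated configurations, convergence of the exponential statistics of a separating
`C_c` family is vague convergence** (every subsequence has, by `stub_vagueSeqCompactOfSeparated`, a vaguely
convergent subsequence, whose limit has the same statistics as `ν`, hence is `ν`). -/
theorem tendsto_of_tendsto_expStat (hgc : ∀ n, Continuous (g n)) (hgs : ∀ n, HasCompactSupport (g n))
    (hsepg : ∀ ω ω' : PointConfig X, (∀ n, ω.sumFn (g n) = ω'.sumFn (g n)) → ω = ω')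
    {δ : ℝ} (hδ : 0 < δ) {ω : ℕ → PointConfig X}
    (hsep : ∀ k, ∀ p ∈ ω k, ∀ q ∈ ω k, p ≠ q → δ ≤ dist p q) {ν : PointConfig X}
    (h : Tendsto (fun k (n : ℕ) => Real.exp (-((ω k).sumFn (g n)))) atTop
      (𝓝 fun n => Real.exp (-(ν.sumFn (g n))))) :
    Tendsto ω atTop (𝓝 ν) := by
  refine tendsto_of_subseq_tendsto fun ns hns => ?_
  obtain ⟨φ, ν', hφ, -, -, hlim⟩ :=
    stub_vagueSeqCompactOfSeparated hδ (fun k => ω (ns k)) fun k => hsep (ns k)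
  refine ⟨φ, ?_⟩
  have h1 : Tendsto (fun k (n : ℕ) => Real.exp (-((ω (ns (φ k))).sumFn (g n)))) atTop
      (𝓝 fun n => Real.exp (-(ν'.sumFn (g n)))) :=
    ((continuous_expStat hgc hgs).tendsto ν').comp hlim
  have h2 : Tendsto (fun k (n : ℕ) => Real.exp (-((ω (ns (φ k))).sumFn (g n)))) atTop
      (𝓝 fun n => Real.exp (-(ν.sumFn (g n)))) :=
    (h.comp hns).comp hφ.tendsto_atTop
  have heq : ν' = ν := injective_expStat hsepg (tendsto_nhds_unique h1 h2)
  rw [← heq]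
  exact hlim

end ExpStat

/-! ## Hard-core configurations of `ℝᵈ × ℝᵈ` -/

section HardCore

variable {d : Type*} [Fintype d]

/-- A `δ`-hard-core configuration is `δ`-separated in phase space (the product norm dominates the norm
of the position component). -/
theorem le_dist_of_isHardCore {δ : ℝ} {ω : PointConfig (EuclideanSpace ℝ d × EuclideanSpace ℝ d)}
    (h : IsHardCore δ ω) : ∀ p ∈ ω, ∀ q ∈ ω, p ≠ q → δ ≤ dist p q := fun p hp q hq hpq =>
  (h p hp q hq hpq).trans (by rw [dist_eq_norm]; exact norm_fst_le (p - q))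

/-- **Vague limits of hard-core configurations are hard core**: if every point of `ν` is, for every
`ε > 0`, eventually `ε`-close to a point of the `δ`-hard-core configurations `ω k`, then `ν` is `δ`-hard
core (two distinct points of `ν` are approached by two distinct particles of one `ω k`). -/
theorem isHardCore_of_approached {δ : ℝ}
    {ω : ℕ → PointConfig (EuclideanSpace ℝ d × EuclideanSpace ℝ d)} (hω : ∀ k, IsHardCore δ (ω k))
    {ν : PointConfig (EuclideanSpace ℝ d × EuclideanSpace ℝ d)}
    (hν : ∀ p ∈ ν, ∀ ε : ℝ, 0 < ε → ∀ᶠ k in atTop, ∃ q ∈ ω k, dist q p < ε) :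
    IsHardCore δ ν := by
  intro p hp q hq hpq
  refine le_of_forall_pos_lt_add fun η hη => ?_
  have hpq0 : 0 < dist p q := dist_pos.2 hpq
  set ε : ℝ := min (η / 2) (dist p q / 2) with hε_def
  have hε : 0 < ε := lt_min (half_pos hη) (half_pos hpq0)
  have hεη : ε ≤ η / 2 := min_le_left _ _
  have hεpq : ε ≤ dist p q / 2 := min_le_right _ _
  obtain ⟨k, ⟨a, ha, hap⟩, ⟨b, hb, hbq⟩⟩ := ((hν p hp ε hε).and (hν q hq ε hε)).exists
  have hab : a ≠ b := by
    rintro rfl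
    have : dist p q ≤ dist a p + dist a q := dist_triangle_left _ _ _
    linarith
  have h1 := hω k a ha b hb hab
  have hap' : ‖a.1 - p.1‖ < ε :=
    lt_of_le_of_lt ((norm_fst_le (a - p)).trans_eq (dist_eq_norm a p).symm) hap
  have hbq' : ‖b.1 - q.1‖ < ε :=
    lt_of_le_of_lt ((norm_fst_le (b - q)).trans_eq (dist_eq_norm b q).symm) hbq
  have h2 : ‖a.1 - b.1‖ ≤ ‖a.1 - p.1‖ + ‖p.1 - q.1‖ + ‖b.1 - q.1‖ :=
    calc ‖a.1 - b.1‖ = ‖(a.1 - p.1) + (p.1 - q.1) - (b.1 - q.1)‖ := by congr 1; abel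
      _ ≤ ‖a.1 - p.1‖ + ‖p.1 - q.1‖ + ‖b.1 - q.1‖ :=
          (norm_sub_le _ _).trans (add_le_add (norm_add_le _ _) le_rfl)
  linarith

variable {g : ℕ → EuclideanSpace ℝ d × EuclideanSpace ℝ d → ℝ}

/-- **The image of the hard-core configurations under the exponential statistics of a `C_c` family is
closed** in the cube (a limit of `F ω_n`, `ω_n` hard core, is `F ν` for a vague subsequential limit `ν`,
which is hard core). -/
theorem isClosed_image_expStat (hgc : ∀ n, Continuous (g n)) (hgs : ∀ n, HasCompactSupport (g n))
    {δ : ℝ} (hδ : 0 < δ) :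
    IsClosed ((fun (ω : PointConfig (EuclideanSpace ℝ d × EuclideanSpace ℝ d)) (n : ℕ) =>
      Real.exp (-(ω.sumFn (g n)))) '' {ω | IsHardCore δ ω}) := by
  refine IsSeqClosed.isClosed fun z y hz hzy => ?_
  choose ω hω hωz using hz
  obtain ⟨φ, ν, hφ, -, happ, hlim⟩ :=
    stub_vagueSeqCompactOfSeparated hδ ω fun k => le_dist_of_isHardCore (hω k)
  have hν : IsHardCore δ ν := isHardCore_of_approached (fun k => hω (φ k)) happ
  refine ⟨ν, hν, ?_⟩
  have h1 : Tendsto (fun k (n : ℕ) => Real.exp (-((ω (φ k)).sumFn (g n)))) atTop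
      (𝓝 fun n => Real.exp (-(ν.sumFn (g n)))) :=
    ((continuous_expStat hgc hgs).tendsto ν).comp hlim
  have h2 : Tendsto (fun k (n : ℕ) => Real.exp (-((ω (φ k)).sumFn (g n)))) atTop (𝓝 y) := by
    have : (fun k (n : ℕ) => Real.exp (-((ω (φ k)).sumFn (g n)))) = z ∘ φ :=
      funext fun k => hωz (φ k)
    rw [this]
    exact hzy.comp hφ.tendsto_atTop
  exact tendsto_nhds_unique h1 h2

/-- The image of the hard-core configurations under the exponential statistics of a `C_c⁺` family is
compact (closed in the cube `ℕ → [0, 1]`). -/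
theorem isCompact_image_expStat (hgc : ∀ n, Continuous (g n)) (hgs : ∀ n, HasCompactSupport (g n))
    (hg0 : ∀ n x, 0 ≤ g n x) {δ : ℝ} (hδ : 0 < δ) :
    IsCompact ((fun (ω : PointConfig (EuclideanSpace ℝ d × EuclideanSpace ℝ d)) (n : ℕ) =>
      Real.exp (-(ω.sumFn (g n)))) '' {ω | IsHardCore δ ω}) :=
  (isCompact_univ_pi fun _ : ℕ => isCompact_Icc).of_isClosed_subset (isClosed_image_expStat hgc hgs hδ)
    (by
      rintro _ ⟨ω, -, rfl⟩
      exact fun n _ => expStat_mem_Icc hg0 ω n)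

/-! ## Hard-core laws are vaguely relatively compact -/

/-- **Hard-core laws are vaguely relatively compact** — the body of the named fact `HardCoreLawsVaguelyCompact`
(Kallenberg 2002, Lemma 16.15 + Thm. 16.16 + Thm. A2.3 (ii), specialised to laws of `δ`-hard-core simple
configurations in `ℝᵈ × ℝᵈ`): every sequence of probability laws on `PointConfig (ℝᵈ × ℝᵈ)` that are almost
surely `δ`-hard core (`δ > 0`) admits a probability law `μ`, almost surely `δ`-hard core, which is a vague
cluster point of the sequence: along a subsequence the Laplace functionals converge to those of `μ` for every
continuous compactly supported `f ≥ 0`. Proof: embed the hard-core configurations by the exponential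
statistics `F` of a separating `C_c⁺` family into their compact metrisable image `Z`; `ProbabilityMeasure Z`
is compact (Riesz–Markov, Mathlib) and metrisable (Lévy–Prokhorov), so the pushed laws converge along a
subsequence; pull the limit back by the vaguely continuous, count-measurable inverse `S : Z → K_δ`; the
Laplace integrands `exp (-∑ f)` are bounded continuous on `Z`. Registered stub of line `FirstLemma`. -/
theorem stub_hardCoreLawsVaguelyCompact :
    ∀ (d : Type) [Fintype d] (δ : ℝ), 0 < δ →
      ∀ P : ℕ → MeasureTheory.Measure (Literature.Analysis.FunctionSpaces.PointConfig (EuclideanSpace ℝ d × EuclideanSpace ℝ d)),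
        (∀ k, MeasureTheory.IsProbabilityMeasure (P k)) →
        (∀ k, Filter.Eventually (fun ω => Literature.Analysis.FluidPDE.IsHardCore δ ω) (MeasureTheory.ae (P k))) →
        ∃ μ : MeasureTheory.Measure (Literature.Analysis.FunctionSpaces.PointConfig (EuclideanSpace ℝ d × EuclideanSpace ℝ d)),
          MeasureTheory.IsProbabilityMeasure μ ∧
            Filter.Eventually (fun ω => Literature.Analysis.FluidPDE.IsHardCore δ ω) (MeasureTheory.ae μ) ∧
            Literature.MathematicalPhysics.KineticTheory.PointProcess.IsVagueClusterPoint μ P := by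
  intro d _ δ hδ P hP hPhc
  classical
  -- a separating family and its exponential statistics `F`
  obtain ⟨g, hgc, hgs, hg0, hsepg⟩ :=
    exists_separating_family (X := EuclideanSpace ℝ d × EuclideanSpace ℝ d)
  set K : Set (PointConfig (EuclideanSpace ℝ d × EuclideanSpace ℝ d)) := {ω | IsHardCore δ ω} with hK
  set F : PointConfig (EuclideanSpace ℝ d × EuclideanSpace ℝ d) → ℕ → ℝ :=
    fun ω n => Real.exp (-(ω.sumFn (g n))) with hF
  have hFmeas : Measurable F := measurable_expStat hgc hgs hg0
  have hFinj : Injective F := injective_expStat hsepg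
  set Zs : Set (ℕ → ℝ) := F '' K with hZs
  have hZclosed : IsClosed Zs := isClosed_image_expStat hgc hgs hδ
  have hZcomp : IsCompact Zs := isCompact_image_expStat hgc hgs hg0 hδ
  have hKmeas : MeasurableSet K := by
    have hKeq : F ⁻¹' Zs = K := hFinj.preimage_image _
    rw [← hKeq]
    exact hFmeas hZclosed.measurableSet
  haveI : CompactSpace Zs := isCompact_iff_compactSpace.1 hZcomp
  -- the inverse `S : Z → K`
  set S : Zs → PointConfig (EuclideanSpace ℝ d × EuclideanSpace ℝ d) := fun z => z.2.choose with hS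
  have hSK : ∀ z : Zs, IsHardCore δ (S z) := fun z => z.2.choose_spec.1
  have hFS : ∀ z : Zs, F (S z) = z := fun z => z.2.choose_spec.2
  have hSF : ∀ ω (h : F ω ∈ Zs), S ⟨F ω, h⟩ = ω := fun ω h => hFinj (hFS ⟨F ω, h⟩)
  have hScont : Continuous S := by
    refine continuous_iff_seqContinuous.2 fun z y hzy => ?_
    have h1 : Tendsto (fun k => F (S (z k))) atTop (𝓝 (F (S y))) := by
      have h2 : Tendsto (fun k => ((z k : Zs) : ℕ → ℝ)) atTop (𝓝 (y : ℕ → ℝ)) :=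
        (continuous_subtype_val.tendsto y).comp hzy
      rw [show (fun k => F (S (z k))) = fun k => ((z k : Zs) : ℕ → ℝ) from funext fun k => hFS (z k),
        hFS y]
      exact h2
    exact tendsto_of_tendsto_expStat hgc hgs hsepg hδ (fun k => le_dist_of_isHardCore (hSK (z k))) h1
  have hSmeas : Measurable S := stub_measurableOfVagueContinuous hScont
  -- the projection `F' : PointConfig → Z` (equal to `F` on `K`)
  set z₀ : Zs := ⟨F ∅, ∅, isHardCore_empty δ, rfl⟩ with hz₀
  set F' : PointConfig (EuclideanSpace ℝ d × EuclideanSpace ℝ d) → Zs := fun ω =>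
    if h : ω ∈ F ⁻¹' Zs then (⟨F ω, h⟩ : Zs) else z₀ with hF'
  have hF'meas : Measurable F' :=
    Measurable.dite (f := fun x : F ⁻¹' Zs => (⟨F x.1, x.2⟩ : Zs))
      ((hFmeas.comp measurable_subtype_coe).subtype_mk) measurable_const
      (hZclosed.measurableSet.preimage hFmeas)
  have hF'K : ∀ ω ∈ K, S (F' ω) = ω := by
    intro ω hω
    have h : ω ∈ F ⁻¹' Zs := ⟨ω, hω, rfl⟩
    have : F' ω = ⟨F ω, h⟩ := dif_pos h
    rw [this, hSF ω h]
  -- the pushed laws on the compact metrisable space `Z` and a convergent subsequence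
  haveI := hP
  set Pz : ℕ → ProbabilityMeasure Zs := fun k =>
    ⟨(P k).map F', Measure.isProbabilityMeasure_map hF'meas.aemeasurable⟩ with hPz
  obtain ⟨ρ, κ, hκ, hlim⟩ := CompactSpace.tendsto_subseq Pz
  -- the limit law on configurations
  set μ : Measure (PointConfig (EuclideanSpace ℝ d × EuclideanSpace ℝ d)) :=
    (ρ : Measure Zs).map S with hμ
  haveI : IsProbabilityMeasure μ := Measure.isProbabilityMeasure_map hSmeas.aemeasurable
  refine ⟨μ, inferInstance, ?_, κ, hκ, fun f hf hcs h0 => ?_⟩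
  · exact (ae_map_iff hSmeas.aemeasurable hKmeas).2 (ae_of_all _ fun z => hSK z)
  · -- the Laplace integrand as a bounded continuous function on `Z`
    have hGcont : Continuous fun z : Zs => Real.exp (-((S z).sumFn f)) :=
      Real.continuous_exp.comp ((PointConfig.continuous_sumFn' hf hcs).comp hScont).neg
    set G : Zs →ᵇ ℝ := BoundedContinuousFunction.mkOfCompact ⟨_, hGcont⟩ with hG
    have hGapply : ∀ z, G z = Real.exp (-((S z).sumFn f)) := fun z => rfl
    have hmeasf : Measurable fun ω : PointConfig (EuclideanSpace ℝ d × EuclideanSpace ℝ d) =>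
        Real.exp (-(∑ᶠ p ∈ (ω : Set (EuclideanSpace ℝ d × EuclideanSpace ℝ d)), f p)) :=
      measurable_exp_neg_finsum hf.measurable hcs h0
    -- Laplace functionals of the `P k` are expectations of `G` under the pushed laws
    have hPk : ∀ k, laplaceFunctional (P k) f = ∫ z, G z ∂(Pz k : Measure Zs) := by
      intro k
      have hmap : ((Pz k : ProbabilityMeasure Zs) : Measure Zs) = (P k).map F' := rfl
      rw [hmap, integral_map hF'meas.aemeasurable G.continuous.measurable.aestronglyMeasurable]
      refine integral_congr_ae ?_
      filter_upwards [hPhc k] with ω hω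
      rw [hGapply, hF'K ω hω, PointConfig.sumFn_def]
    -- and so is the Laplace functional of `μ`
    have hμf : laplaceFunctional μ f = ∫ z, G z ∂(ρ : Measure Zs) := by
      show ∫ ω, Real.exp (-(∑ᶠ p ∈ (ω : Set (EuclideanSpace ℝ d × EuclideanSpace ℝ d)), f p)) ∂μ = _
      rw [hμ, integral_map hSmeas.aemeasurable hmeasf.aestronglyMeasurable]
      rfl
    rw [hμf]
    simp only [hPk]
    exact (ProbabilityMeasure.tendsto_iff_forall_integral_tendsto.1 hlim G)

end HardCore

end Summit.AtomisticToContinuum.HydrodynamicLimit.Theorems.KiferCompactification
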